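import Mathlib
import Summits.Ventures.HodgeRepro0.P1LatticeBlockDictBridgeA

/-!
# P1LatticeBlockDictConv — D13's THEOREM A (proofs/P1-FermatLatticeClosure-v1.2.md l.4, DECLARED STATUS l.4789): ONE BLOCK SET —
THE CONVERSE DICTIONARY, THE GENERAL LEMMAS AND THE BRIDGE FOR THE NAMESPACE A (pub-hodge-repro0, p1 (g29), 2026-08-30), on
lean/P1LatticeBlockDict.lean and the dictionary bridge lean/P1LatticeBlockDictBridgeA.lean.

Supporting artefact in the sense of ROUTE.md R-5 (finite combinatorics / exact arithmetic only; never the discharge of a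
Hodge-theoretic step; record-only).  lean/P1LatticeBlockDict*.lean proved the dictionary g27 → g28: a legitimate g27
`Block`'s multiset at M is an `IsBlock M` multiset.  THIS ARTEFACT proves the converse — every `IsBlock M` multiset is the
multiset at M of a legitimate g27 block: a Hodge 4-multiset or a split Hodge 6-multiset of level M as its own base at the
level M with t = 1 (the g27 Bools `isHodge` / `split6` / `isPrime` FROM the predicates; the split through the first entry by
listing the zero-sum triple first), and Aoki's σ_{p,i} of level M with g := gcd(i, M/p) as the pull-back by g of σ_{p, i/g}
of level M/g (gcd(i/g, (M/g)/p) = 1 and (M/g)/p = (M/p)/g > 2; the σ identity `sigma_pull` with t = 1, k = g, and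
`sigma_isHodge` for the base) — so, for every M ≥ 3 and every g27 namespace, THE TWO LATTICES ARE ONE: the g27 L_M (the
span of the odd vectors of all legitimate `Block`s) EQUALS the g28 L_M (the span of the odd vectors of all `IsBlock M`
multisets), `X_L_eq_spanBlock`; the equalities H_M = L_M of lean/P1LatticeIndexOneEqA–B.lean and
lean/P1LatticeBlockDictEq.lean are literally the same statement.

THE LEMMAS, for every M: `pull_self` / `map_pull_self` (at the level M with t = 1 the g27 entry map is the identity below
M); `exists_three`; `sigma_entries_lt`; `sigma_level_facts` — KIND 2, THE ARITHMETIC OF THE LEVEL: for σ_{p,i} of level M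
with g := gcd(i, M/p) there is d′ with M/g = p·d′, (M/p)/g = d′, 0 < g, M = g·(M/g), gcd(i/g, d′) = 1, 0 < i/g < M/g,
i = g·(i/g), 3 ≤ M/g, d′ ∤ i/g; `sigma_eq_pull` — KIND 2, THE MULTISET: σ_{p,i} of level M is the pull-back by g of
σ_{p, i/g} of level M/g (t = 1), by `sigma_pull`.  THE BRIDGE FOR A, in full: `A_isHodge_of` / `A_isPrime_of_prime` (the
g27 Bools FROM the predicates), `A_block_of_isBlock` — THE CONVERSE DICTIONARY (kind 0 / 1 / 2; the g27 `split6` met by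
listing the zero-sum triple first), `A_spanBlock_le_L`, `A_L_le_spanBlock` (the dictionary of
lean/P1LatticeBlockDictBridgeA.lean), `A_L_eq_spanBlock` — THE TWO LATTICES ARE ONE.  The bridges B–I (through A) are in
lean/P1LatticeBlockDictConvBridge.lean, the per-degree instances in lean/P1LatticeBlockDictConvEq.lean.
NOT formalised: claim(·) for the blocks (Shioda 1981 Thm 4.3 / Lefschetz (1,1), Aoki 1987 Thm 2-1 / Thm 1-4); anything
Hodge-theoretic.
Nothing here asserts anything about whether the statement of README §1 has been proved elsewhere.
-/

namespace HodgeRepro0.P1.P1LatticeIndexTwoExact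
open Matrix

/-- at the level M itself with t = 1 the pull-back entry map is the identity on [0, M) -/
theorem pull_self (M x : ℕ) (hM : 0 < M) (hx : x < M) : pull M M 1 x = x := by
  unfold pull
  rw [Nat.div_self hM, Nat.one_mul, Nat.one_mul, Nat.mod_eq_of_lt hx, Nat.mod_eq_of_lt hx]

/-- … and on a list of entries below M -/
theorem map_pull_self (M : ℕ) (hM : 0 < M) (l : List ℕ) (hl : ∀ x ∈ l, x < M) : l.map (pull M M 1) = l := by
  have e : l.map (pull M M 1) = l.map id := List.map_congr_left (fun x hx => by rw [pull_self M x hM (hl x hx), id])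
  rw [e, List.map_id]

/-- a list of length 3 is an explicit three-term list -/
theorem exists_three (l : List ℕ) (h : l.length = 3) : ∃ a b c : ℕ, l = [a, b, c] := by
  rcases l with _ | ⟨a, _ | ⟨b, _ | ⟨c, _ | ⟨x, rest⟩⟩⟩⟩ <;> simp only [List.length_cons, List.length_nil] at h <;> try omega
  exact ⟨a, b, c, rfl⟩

/-- the entries of σ_{p,i} of level mm lie below mm -/
theorem sigma_entries_lt (mm p i : ℕ) (hmm : 0 < mm) : ∀ x ∈ sigma mm p i, x < mm := by
  intro x hx
  simp only [sigma, List.mem_append, List.mem_map, List.mem_range, List.mem_singleton] at hx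
  rcases hx with ⟨j, _, rfl⟩ | rfl <;> exact Nat.mod_lt _ hmm

/-- KIND 2, THE ARITHMETIC OF THE LEVEL: for σ_{p,i} of level M (p ∣ M, 0 < i < M, (M/p)/g > 2) with g := gcd(i, M/p),
there is d′ with M/g = p·d′ and (M/p)/g = d′; 0 < g, M = g·(M/g), gcd(i/g, d′) = 1, 0 < i/g < M/g, i = g·(i/g), 3 ≤ M/g, d′ ∤ i/g -/
theorem sigma_level_facts (M p i g : ℕ) (hp : Nat.Prime p) (hdvd : M % p = 0) (hi0 : 0 < i) (hiM : i < M)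
    (hg : 2 < (M / p) / g) (hgdef : g = Nat.gcd i (M / p)) :
    ∃ d' : ℕ, M / g = p * d' ∧ (M / p) / g = d' ∧ 0 < g ∧ M = g * (M / g) ∧ Nat.gcd (i / g) d' = 1 ∧ 0 < i / g ∧
      i / g < M / g ∧ i = g * (i / g) ∧ 3 ≤ M / g ∧ ¬ d' ∣ (i / g) := by
  have hp0 : 0 < p := hp.pos
  have hpM : p ∣ M := Nat.dvd_of_mod_eq_zero hdvd
  obtain ⟨d, hd⟩ : ∃ d, M = p * d := ⟨M / p, (Nat.mul_div_cancel' hpM).symm⟩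
  have hdp : M / p = d := by rw [hd, Nat.mul_div_cancel_left d hp0]
  rw [hdp] at hgdef hg
  have hg0 : 0 < g := by rw [hgdef]; exact Nat.gcd_pos_of_pos_left _ hi0
  have hgi : g ∣ i := by rw [hgdef]; exact Nat.gcd_dvd_left _ _
  have hgd : g ∣ d := by rw [hgdef]; exact Nat.gcd_dvd_right _ _
  obtain ⟨d', hd'⟩ : ∃ d', d = g * d' := ⟨d / g, (Nat.mul_div_cancel' hgd).symm⟩
  have hdg : d / g = d' := by rw [hd', Nat.mul_div_cancel_left d' hg0]
  have hMg : M = g * (p * d') := by rw [hd, hd']; ring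
  have hMdg : M / g = p * d' := by rw [hMg, Nat.mul_div_cancel_left _ hg0]
  have hgM : g ∣ M := Dvd.intro _ hMg.symm
  rw [hdg] at hg
  have hcop : Nat.gcd (i / g) d' = 1 := by
    have := Nat.coprime_div_gcd_div_gcd (m := i) (n := d) (by rw [← hgdef]; exact hg0)
    rw [← hgdef, hdg] at this
    exact this
  refine ⟨d', hMdg, by rw [hdp, hdg], hg0, (Nat.mul_div_cancel' hgM).symm, hcop, Nat.div_pos (Nat.le_of_dvd hi0 hgi) hg0,
    Nat.div_lt_div_of_lt_of_dvd hgM hiM, (Nat.mul_div_cancel' hgi).symm, ?_, ?_⟩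
  · rw [hMdg]
    have := hp.two_le
    nlinarith
  · intro h
    have := Nat.gcd_eq_right h
    omega

/-- KIND 2, THE MULTISET: σ_{p,i} of level M is the pull-back by g of σ_{p, i/g} of level M/g (t = 1) -/
theorem sigma_eq_pull (M p i g : ℕ) (hp : Nat.Prime p) (hdvd : M % p = 0) (hi0 : 0 < i) (hiM : i < M)
    (hg : 2 < (M / p) / g) (hgdef : g = Nat.gcd i (M / p)) :
    ((sigma M p i : List ℕ) : Multiset ℕ) = (((sigma (M / g) p (i / g)).map (pull M (M / g) 1) : List ℕ) : Multiset ℕ) := by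
  obtain ⟨d', hMdg, hdg, hg0, hMg, hcop, hi0', hilt, hig, hM3, hndvd⟩ := sigma_level_facts M p i g hp hdvd hi0 hiM hg hgdef
  have hm0 : 0 < M / g := by omega
  have hpd : (M / g) % p = 0 := by rw [hMdg, Nat.mul_mod_right]
  have hdi : ¬ ((M / g) / p) ∣ (i / g) := by
    rw [hMdg, Nat.mul_div_cancel_left d' hp.pos]
    exact hndvd
  rw [sigma_pull M (M / g) 1 g p (i / g) hMg hg0 hp.pos hpd hm0 hdi (Nat.gcd_one_left M)]
  rw [Nat.mul_one, ← hig]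

/-! ## The converse bridge for the namespace `P1LatticeIndexOneA` (the degree file A) -/

/-- (A) their Bool Hodge test FROM the multiset predicate -/
theorem A_isHodge_of (mm : ℕ) (x : List ℕ) (hH : IsHodge mm (x : Multiset ℕ)) : P1LatticeIndexOneA.isHodge mm x = true := by
  obtain ⟨hev, hent, hwt⟩ := hH
  simp only [P1LatticeIndexOneA.isHodge, Bool.and_eq_true, beq_iff_eq, List.all_eq_true, bne_iff_ne, ne_eq,
    List.mem_filter, List.mem_range, decide_eq_true_eq]
  refine ⟨⟨?_, ?_⟩, ?_⟩
  · rw [Multiset.coe_card, Nat.even_iff] at hev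
    exact hev
  · intro a ha
    have := hent a (Multiset.mem_coe.mpr ha)
    rw [Nat.mod_eq_of_lt this.2]
    omega
  · rintro u ⟨hu, hg⟩
    have := hwt u hu hg
    rw [wt_coe, Multiset.coe_card] at this
    exact this

/-- (A) their trial-division primality test FROM `Nat.Prime` -/
theorem A_isPrime_of_prime (p : ℕ) (hp : Nat.Prime p) : P1LatticeIndexOneA.isPrime p = true := by
  simp only [P1LatticeIndexOneA.isPrime, Bool.and_eq_true, decide_eq_true_eq, List.all_eq_true, List.mem_range,
    Bool.or_eq_true, bne_iff_ne, ne_eq]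
  refine ⟨hp.two_le, fun r hr => ?_⟩
  by_cases h2 : r < 2
  · exact Or.inl h2
  · refine Or.inr fun hmod => ?_
    rcases (Nat.Prime.eq_one_or_self_of_dvd hp r (Nat.dvd_of_mod_eq_zero hmod)) with h | h <;> omega

/-- (A) THE CONVERSE DICTIONARY: every `IsBlock M` multiset is the multiset at M of a legitimate g27 block — a Hodge
4-multiset or a split Hodge 6-multiset as its own base at the level M (t = 1), a σ_{p,i} as the pull-back by g = gcd(i, M/p)
of σ_{p, i/g} of the level M/g -/
theorem A_block_of_isBlock (M : ℕ) (hM : 3 ≤ M) (m : Multiset ℕ) (hm : IsBlock M m) :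
    ∃ b : P1LatticeIndexOneA.Block, b.ok M = true ∧ m = ((b.ms M : List ℕ) : Multiset ℕ) := by
  have hM0 : 0 < M := by omega
  rcases hm with ⟨hc, hH⟩ | ⟨T₁, T₂, rfl, h1, h2, hs1, _, hH⟩ | ⟨p, i, hp, hodd, hdvd, hi0, hiM, hg, rfl⟩
  · -- kind 0
    obtain ⟨l, rfl⟩ : ∃ l : List ℕ, ((l : List ℕ) : Multiset ℕ) = m := Quot.exists_rep m
    have hlt : ∀ x ∈ l, x < M := fun x hx => (hH.2.1 x (Multiset.mem_coe.mpr hx)).2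
    refine ⟨⟨M, 1, 0, l, 0, 0⟩, ?_, ?_⟩
    · unfold P1LatticeIndexOneA.Block.ok
      rw [if_pos (by simp)]
      simp only [Bool.and_eq_true, beq_iff_eq, decide_eq_true_eq, List.all_eq_true]
      refine ⟨⟨⟨⟨⟨Nat.mod_self M, hM⟩, Nat.gcd_one_left M⟩, hlt⟩, A_isHodge_of M l hH⟩, ?_⟩
      rw [Multiset.coe_card] at hc
      exact hc
    · show ((l : List ℕ) : Multiset ℕ) = ((l.map (pull M M 1) : List ℕ) : Multiset ℕ)
      rw [map_pull_self M hM0 l hlt]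
  · -- kind 1
    obtain ⟨a, b, c, rfl⟩ := exists_three T₁ h1
    have hlt : ∀ x ∈ [a, b, c] ++ T₂, x < M := fun x hx => (hH.2.1 x (Multiset.mem_coe.mpr hx)).2
    refine ⟨⟨M, 1, 1, [a, b, c] ++ T₂, 0, 0⟩, ?_, ?_⟩
    · unfold P1LatticeIndexOneA.Block.ok
      rw [if_neg (by simp), if_pos (by simp)]
      simp only [Bool.and_eq_true, beq_iff_eq, decide_eq_true_eq, List.all_eq_true]
      refine ⟨⟨⟨⟨⟨Nat.mod_self M, hM⟩, Nat.gcd_one_left M⟩, hlt⟩, A_isHodge_of M _ hH⟩, ?_⟩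
      unfold P1LatticeIndexOneA.split6
      simp only [Bool.and_eq_true, beq_iff_eq, List.any_eq_true]
      refine ⟨by simp [h2], (1, 2), by simp, ?_⟩
      show (a + b + c) % M = 0
      simp only [List.sum_cons, List.sum_nil, Nat.add_zero] at hs1
      rw [Nat.add_assoc]
      exact hs1
    · show (([a, b, c] ++ T₂ : List ℕ) : Multiset ℕ) = ((([a, b, c] ++ T₂).map (pull M M 1) : List ℕ) : Multiset ℕ)
      rw [map_pull_self M hM0 _ hlt]
  · -- kind 2
    have hpull := sigma_eq_pull M p i _ hp hdvd hi0 hiM hg rfl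
    obtain ⟨d', hMdg, hdg, hg0, hMg, hcop, hi0', hilt, hig, hM3, hndvd⟩ :=
      sigma_level_facts M p i (Nat.gcd i (M / p)) hp hdvd hi0 hiM hg rfl
    have hg' : 2 < d' := by rw [← hdg]; exact hg
    have hm0 : 0 < M / Nat.gcd i (M / p) := by omega
    have hpd : (M / Nat.gcd i (M / p)) % p = 0 := by rw [hMdg, Nat.mul_mod_right]
    have hqd : (M / Nat.gcd i (M / p)) / p = d' := by rw [hMdg, Nat.mul_div_cancel_left d' hp.pos]
    have hd2 : 2 < (M / Nat.gcd i (M / p)) / p := by rw [hqd]; exact hg'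
    have hsH : IsHodge (M / Nat.gcd i (M / p))
        ((sigma (M / Nat.gcd i (M / p)) p (i / Nat.gcd i (M / p)) : List ℕ) : Multiset ℕ) :=
      sigma_isHodge _ p _ hp hodd hpd hi0' hilt (by rw [hqd, hcop, Nat.div_one]; exact hg')
    have hdivM : M % (M / Nat.gcd i (M / p)) = 0 :=
      Nat.mod_eq_zero_of_dvd (Nat.div_dvd_of_dvd (Dvd.intro _ hMg.symm))
    refine ⟨⟨M / Nat.gcd i (M / p), 1, 2, sigma (M / Nat.gcd i (M / p)) p (i / Nat.gcd i (M / p)), p,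
      i / Nat.gcd i (M / p)⟩, ?_, ?_⟩
    · unfold P1LatticeIndexOneA.Block.ok
      rw [if_neg (by simp), if_neg (by simp)]
      simp only [Bool.and_eq_true, beq_iff_eq, decide_eq_true_eq, List.all_eq_true]
      refine ⟨⟨⟨⟨⟨hdivM, hM3⟩, Nat.gcd_one_left M⟩, sigma_entries_lt _ p _ hm0⟩, A_isHodge_of _ _ hsH⟩,
        ⟨⟨⟨⟨⟨⟨trivial, A_isPrime_of_prime p hp⟩, hodd⟩, hpd⟩, hd2⟩, by rw [hqd]; exact hcop⟩, rfl⟩⟩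
    · exact hpull

/-- (A) the g28 L_M ≤ the g27 L_M -/
theorem A_spanBlock_le_L {n : ℕ} (M : ℕ) (hM : 3 ≤ M) :
    Submodule.span ℤ ((oddVec (n := n) M) '' {m | IsBlock M m}) ≤ A_L M n := by
  rw [Submodule.span_le]
  rintro _ ⟨m, hm, rfl⟩
  obtain ⟨b, hb, rfl⟩ := A_block_of_isBlock M hM m hm
  refine Submodule.subset_span ⟨b.ms M, ⟨b, hb, rfl⟩, ?_⟩
  funext a
  simp [P1LatticeIndexOneA.oddVec, oddVec, Multiset.coe_count]

/-- (A) the g27 L_M ≤ the g28 L_M (the dictionary of lean/P1LatticeBlockDictBridge*.lean) -/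
theorem A_L_le_spanBlock {n : ℕ} (M : ℕ) (hM : 0 < M) :
    A_L M n ≤ Submodule.span ℤ ((oddVec (n := n) M) '' {m | IsBlock M m}) := by
  rw [Submodule.span_le]
  rintro _ ⟨ms, ⟨b, hb, rfl⟩, rfl⟩
  refine Submodule.subset_span ⟨((b.ms M : List ℕ) : Multiset ℕ), A_isBlock_of_ok M hM b hb, ?_⟩
  funext a
  simp [P1LatticeIndexOneA.oddVec, oddVec, Multiset.coe_count]

/-- (A) THE TWO LATTICES ARE ONE: for every M ≥ 3 and n, the g27 L_M equals the g28 L_M -/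
theorem A_L_eq_spanBlock {n : ℕ} (M : ℕ) (hM : 3 ≤ M) :
    A_L M n = Submodule.span ℤ ((oddVec (n := n) M) '' {m | IsBlock M m}) :=
  le_antisymm (A_L_le_spanBlock M (by omega)) (A_spanBlock_le_L M hM)

end HodgeRepro0.P1.P1LatticeIndexTwoExact
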